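import Summits.CriticalPhenomena.SAWScalingLimit.Theorems.CriticalBubbleBound.Negative.CriticalBubbleBoundOneNumber

/-!
# Discrete subharmonicity of the SAW two-point kernel of `ℤ²`

Refuter file (cdisprove gen 5, crux item stmt-CriticalPhenomena-7117 = `SAWTotalPositivity.CriticalBubbleBound`),
supporting lemmas only — no Theses statement is asserted. Companion of
`CriticalBubbleBoundPointwise.lean` (which propagates FINITENESS of `K_x(0,e₀)` to every site).

Last-step decomposition of `K_x(0,b) = Σ_{γ : 0 → b SAW of ℤ²} x^{|γ|}` (`latticeKernel`): for
`b ≠ 0` every SAW `0 → b` has a penultimate vertex `b' ∼ b`, and dropping the last edge is injective,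
so `K_x(0,b) ≤ x · Σ_{b' ∼ b} K_x(0,b')` (`latticeKernel_subharmonic`) — the SAW two-point function
is `x`-subharmonic off the origin. Consequence for the DISPROOF side of the crux
(`¬ CriticalBubbleBound ⟺ K_{x_c}(0,e₀) = ∞`): an infinite value at a site `b ≠ 0` forces an
infinite value at some neighbour of `b` (`exists_adj_latticeKernel_eq_top`) — infinities come in
connected clusters reaching towards the origin; whether `K_{x_c}(0,e₀) = ∞` would force
`K_{x_c}(0,b) = ∞` at EVERY `b ≠ 0` is a Harnack-type comparability not attempted here.
(For `x < 1/4` subharmonicity bounds `K_x` by the simple-random-walk Green function; at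
`x_c > 1/4` it carries no size information — cf. the memoryless model of the work file, §14.)
-/

noncomputable section

open MeasureTheory Filter Topology Set Function
open Literature.Probability.LatticeModels Literature.Probability.Percolation
open Literature.Probability.RandomPlanarGeometry Literature.Probability.RandomPlanarGeometry.SAW
open Literature.Barriers.CriticalPhenomena.SupercriticalSAW
open scoped ENNReal NNReal BigOperators

namespace Summit.CriticalPhenomena.SAWScalingLimit.Theorems.CriticalBubbleBound.Negative

/-! ## Last-step decomposition: discrete subharmonicity of the kernel -/

/-- SAWs `0 → b` whose penultimate vertex is `b'`. -/
def LastFrom (b' b : Site 2) : Set (LatticeSAW 0 b) := {p | p.1.penultimate = b'}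

/-- Dropping the last edge of a SAW `0 → b` with penultimate vertex `b'`: a SAW `0 → b'`. [folklore] -/
def dropLastTo {b' b : Site 2} (p : LastFrom b' b) : LatticeSAW 0 b' :=
  ⟨p.1.1.dropLast.copy rfl p.2, by simpa using p.1.2.dropLast⟩

/-- Dropping the last edge loses one step. [folklore] -/
theorem length_dropLastTo {b' b : Site 2} (p : LastFrom b' b) :
    (dropLastTo p).1.length = p.1.1.length - 1 := by
  simp [dropLastTo, SimpleGraph.Walk.length_dropLast]

/-- Dropping the last edge is injective on SAWs `0 → b ≠ 0` with a given penultimate vertex. [folklore] -/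
theorem dropLastTo_injective {b' b : Site 2} (hb : b ≠ 0) : Injective (dropLastTo (b' := b') (b := b)) := by
  rintro ⟨⟨p, hp⟩, hpb⟩ ⟨⟨q, hq⟩, hqb⟩ hpq
  have hs : (p.dropLast.copy rfl hpb).support = (q.dropLast.copy rfl hqb).support :=
    congrArg (fun r : LatticeSAW 0 b' => r.1.support) hpq
  simp only [SimpleGraph.Walk.support_copy] at hs
  have hpn : ¬ p.Nil := fun h => hb h.eq.symm
  have hqn : ¬ q.Nil := fun h => hb h.eq.symm
  have hp' := SimpleGraph.Walk.concat_dropLast (SimpleGraph.Walk.adj_penultimate hpn)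
  have hq' := SimpleGraph.Walk.concat_dropLast (SimpleGraph.Walk.adj_penultimate hqn)
  have : p.support = q.support := by
    rw [← hp', ← hq', SimpleGraph.Walk.support_concat, SimpleGraph.Walk.support_concat, hs]
  have hpq' : p = q := SimpleGraph.Walk.support_injective this
  subst hpq'
  rfl

/-- **Discrete subharmonicity.** For `b ≠ 0` and `x ≥ 0`:
`K_x(0,b) ≤ x · Σ_{b' ∼ b} K_x(0,b')` (drop the last step). [folklore] -/
theorem latticeKernel_subharmonic {x : ℝ} (hx : 0 ≤ x) {b : Site 2} (hb : b ≠ 0) :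
    latticeKernel x 0 b ≤ ENNReal.ofReal x * ∑ b' ∈ (zdGraph 2).neighborFinset b, latticeKernel x 0 b' := by
  classical
  set f : LatticeSAW 0 b → ℝ≥0∞ := fun p => ENNReal.ofReal (x ^ p.1.length) with hf
  -- every SAW `0 → b` has its penultimate vertex among the neighbours of `b`
  have hpt : ∀ p : LatticeSAW 0 b, f p ≤
      ∑ b' ∈ (zdGraph 2).neighborFinset b, (LastFrom b' b).indicator f p := by
    intro p
    have hpn : ¬ p.1.Nil := fun h => hb h.eq.symm
    have hmem : p.1.penultimate ∈ (zdGraph 2).neighborFinset b :=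
      (SimpleGraph.mem_neighborFinset _ _ _).2 (SimpleGraph.Walk.adj_penultimate hpn).symm
    refine le_trans ?_ (Finset.single_le_sum (f := fun b' => (LastFrom b' b).indicator f p)
      (fun _ _ => zero_le) hmem)
    rw [Set.indicator_of_mem (show p ∈ LastFrom p.1.penultimate b from rfl)]
  -- each class injects into the SAWs `0 → b'`, losing one step
  have hcls : ∀ b' : Site 2, ∑' p : LatticeSAW 0 b, (LastFrom b' b).indicator f p ≤
      ENNReal.ofReal x * latticeKernel x 0 b' := by
    intro b'
    rw [← tsum_subtype (LastFrom b' b) f]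
    have key : ∀ p : LastFrom b' b, f p = ENNReal.ofReal x *
        (fun q : LatticeSAW 0 b' => ENNReal.ofReal (x ^ q.1.length)) (dropLastTo p) := by
      intro p
      have hpn : ¬ p.1.1.Nil := fun h => hb h.eq.symm
      have hlen : 0 < p.1.1.length := SimpleGraph.Walk.not_nil_iff_lt_length.1 hpn
      simp only [hf, length_dropLastTo]
      rw [← ENNReal.ofReal_mul hx, ← pow_succ', Nat.sub_add_cancel hlen]
    calc ∑' p : LastFrom b' b, f p
        = ∑' p : LastFrom b' b, ENNReal.ofReal x *
            (fun q : LatticeSAW 0 b' => ENNReal.ofReal (x ^ q.1.length)) (dropLastTo p) := tsum_congr key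
      _ = ENNReal.ofReal x * ∑' p : LastFrom b' b,
            (fun q : LatticeSAW 0 b' => ENNReal.ofReal (x ^ q.1.length)) (dropLastTo p) := ENNReal.tsum_mul_left
      _ ≤ ENNReal.ofReal x * latticeKernel x 0 b' := by
          rw [latticeKernel]
          exact mul_le_mul' le_rfl (ENNReal.tsum_comp_le_tsum_of_injective (dropLastTo_injective hb) _)
  calc latticeKernel x 0 b = ∑' p, f p := rfl
    _ ≤ ∑' p, ∑ b' ∈ (zdGraph 2).neighborFinset b, (LastFrom b' b).indicator f p := ENNReal.tsum_le_tsum hpt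
    _ = ∑' p, ∑' b' : ((zdGraph 2).neighborFinset b : Finset (Site 2)), (LastFrom b' b).indicator f p := by
        refine tsum_congr fun p => ?_
        rw [Finset.tsum_subtype ((zdGraph 2).neighborFinset b) (fun b' => (LastFrom b' b).indicator f p)]
    _ = ∑' b' : ((zdGraph 2).neighborFinset b : Finset (Site 2)), ∑' p, (LastFrom b' b).indicator f p :=
        ENNReal.tsum_comm
    _ ≤ ∑' b' : ((zdGraph 2).neighborFinset b : Finset (Site 2)), ENNReal.ofReal x * latticeKernel x 0 b' :=
        ENNReal.tsum_le_tsum fun b' => hcls b'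
    _ = ∑ b' ∈ (zdGraph 2).neighborFinset b, ENNReal.ofReal x * latticeKernel x 0 b' :=
        Finset.tsum_subtype ((zdGraph 2).neighborFinset b) (fun b' => ENNReal.ofReal x * latticeKernel x 0 b')
    _ = ENNReal.ofReal x * ∑ b' ∈ (zdGraph 2).neighborFinset b, latticeKernel x 0 b' := by
        rw [Finset.mul_sum]

/-- **No isolated infinities.** If `K_x(0,b) = ∞` at some `b ≠ 0` then `K_x(0,b') = ∞` at a
neighbour `b'` of `b`. [folklore] -/
theorem exists_adj_latticeKernel_eq_top {x : ℝ} (hx : 0 ≤ x) {b : Site 2} (hb : b ≠ 0)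
    (h : latticeKernel x 0 b = ⊤) : ∃ b' : Site 2, (zdGraph 2).Adj b b' ∧ latticeKernel x 0 b' = ⊤ := by
  by_contra hne
  push Not at hne
  have hfin : ∑ b' ∈ (zdGraph 2).neighborFinset b, latticeKernel x 0 b' ≠ ⊤ :=
    ENNReal.sum_ne_top.2 fun b' hb' => hne b' ((SimpleGraph.mem_neighborFinset _ _ _).1 hb')
  have := latticeKernel_subharmonic hx hb
  rw [h, top_le_iff] at this
  exact ENNReal.mul_ne_top ENNReal.ofReal_ne_top hfin this

end Summit.CriticalPhenomena.SAWScalingLimit.Theorems.CriticalBubbleBound.Negative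

end
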